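import Summits.ResolutionOfSingularities.ResolutionOfSingularities.Theorems.FrobeniusLadderFInjectiveMacaulayficationProp44SliceTauOnePoint
import Summits.ResolutionOfSingularities.ResolutionOfSingularities.Theorems.FrobeniusLadderFInjectiveMacaulayficationProp44StepP
import HarnessLib

/-!
# [CoP1] Prop. 4.4 (`CossartPiltant2008_prop44`, F-71): the isolated `τ = 1` point slice from the chain termination theorem T1 and the
# point-step bookkeeping ρ1′ — the descent with STEP-P PLUGGED IN

[L1 W4.5a · crux `FInjectiveMacaulayfication` (stmt-ResolutionOfSingularities-15315); D-0154 (2) RES inputs cell, seat res-inputs-p-8a (gen 2).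
PROVED composition, definition-free, no new named facts (D-0026). Not a statement of the manuscript under adjudication. AI-written; AI review is
weaker than expert review.]

`…Prop44SliceTauOnePoint.lean` (p623499) assembles the isolated `τ = 1` point slice from the oracles T1 and STEP-P, with STEP-P's line case
(P2) pinned to the whole open `π⁻¹W`. `…Prop44StepP.lean` PROVES the point step from the point-step bookkeeping ρ1′ (res-inputs-p-5a's
`pointStep_curves`, «equal or disjoint» form) — with (P2) relative to an isolating open `W′ ⊆ π⁻¹W` of the bad line (the near locus over
`x` need not be known to be ONE line: two near curves over `x` are equal or disjoint, and the bad one is isolated off the others; critic R56 (3)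
/ R58 (2)). This file re-runs the descent with that step PLUGGED IN (the stage of the line takes `W := W′`; everything else is the landed
device and `exists_pending_of_curve` verbatim):

* `nonempty_next_of_point_of_pointStep` — the next stage after a point stage, from `exists_not_orderReducible_of_point_step`;
* `orderReducible_comap_of_isolated_tau_one_of_T1` — **THE ISOLATED `τ = 1` POINT SLICE** (`stub_tauOne_point` of the patching skeleton
  v5.2, rich form) **FROM THE TWO ORACLES T1** (`stub_T1_false_of_nearChain_tau_one`, candidates `F71_T1_T4_SIGNATURES.lean` v4 l.340,
  binders verbatim) **AND ρ1′**.

`CossartPiltant2008_prop44` is NOT proved (T1 and ρ1′ are hypotheses; T1 is the XL core of the τ = 1 engine); resolution in dimension `≥ 4`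
/ positive characteristic is NOT proved.

References: V. Cossart, O. Piltant, J. Algebra 320 (2008), Lemma 4.3, Prop. 4.4 (proof, pp. 10–11), Lemma 4.5 [CossartPiltant2008].
-/

-- `Summit.<Summit>.<Sub>.Theorems` with `Sub = Summit` (single-conjunct summit, D-0017)
set_option linter.dupNamespace false

noncomputable section

open CategoryTheory CategoryTheory.Limits AlgebraicGeometry TopologicalSpace IsLocalRing
open Literature.AlgebraicGeometry.Resolution Scheme.IdealSheafData

namespace Summit.ResolutionOfSingularities.ResolutionOfSingularities.Theorems

namespace CP2008Prop44

universe u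

section Oracles

variable {m : ℕ} (hm : 1 ≤ m)
  /- ORACLE ρ1′ = res-inputs-p-5a's `pointStep_curves` (REACH signature v2 :104, binders verbatim) with its last clause in the «equal or
  disjoint» form (bus 09:46:49Z; critic R58 (3): one text). -/
  (hρ1 : ∀ ⦃X X' : Scheme.{u}⦄ [IsLocallyNoetherian X] [IsLocallyNoetherian X'] (_hX : Scheme.IsRegular X)
      (_hX3 : topologicalKrullDim X ≤ 3) (J : X.IdealSheafData) ⦃μ : ℕ⦄ (_hμ : 1 ≤ μ) (_hle : ∀ z, idealOrder J z ≤ μ)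
      (_hcodim : ∀ z ∈ J.support, 1 < Order.coheight z) ⦃x : X⦄ (hx : IsClosed ({x} : Set X)) (_hord : idealOrder J x = μ)
      (_hdim : (maximalIdeal (X.presheaf.stalk x)).spanFinrank = 3) ⦃π : X' ⟶ X⦄
      (_hπ : IsBlowup π (vanishingIdeal ⟨{x}, hx⟩)) ⦃η' : X'⦄
      (_hη' : η' ∈ maxPoints {z : X' | (μ : ℕ∞) ≤ idealOrder (controlledTransform π (vanishingIdeal ⟨{x}, hx⟩) J μ) z})
      (_hη'cl : ¬ IsClosed ({η'} : Set X')),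
      (π η' ≠ x ∧ π η' ∈ maxPoints {z : X | (μ : ℕ∞) ≤ idealOrder J z} ∧
          closure ({η'} : Set X') = closure (π ⁻¹' (closure {π η'} \ {x}))) ∨
        (π η' = x ∧ Scheme.IsRegular (vanishingIdeal (⟨closure {η'}, isClosed_closure⟩ : Closeds X')).subscheme ∧
          (∀ y ∈ closure ({η'} : Set X'), ∀ hr : IsRegularLocalRing (X'.presheaf.stalk y),
            ∃ c : Fin 2 → X'.presheaf.stalk y, @IsRsopPart _ _ _ 2 c ∧
              Ideal.span (Set.range c) = stalkIdeal (vanishingIdeal (⟨closure {η'}, isClosed_closure⟩ : Closeds X')) y) ∧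
          ∀ η'' ∈ maxPoints {z : X' | (μ : ℕ∞) ≤ idealOrder (controlledTransform π (vanishingIdeal ⟨{x}, hx⟩) J μ) z},
            ¬ IsClosed ({η''} : Set X') → π η'' = x → η'' = η' ∨ Disjoint (closure ({η'} : Set X')) (closure {η''})))

include hm hρ1 in
/-- **THE POINT STEP of the descent, with STEP-P plugged in.** A stage whose centre is its marked (closed, `τ = 1`, threefold) point has a
next stage: blow the point up; by `exists_not_orderReducible_of_point_step` (from ρ1′) either a near closed `τ = 1` point over it is bad
(next stage = that point), or a near curve `L = cl{η′}` over it, isolated in an open `W′ ⊆ π⁻¹W` off the other near pieces, is bad (next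
stages = the curve lineage of `exists_pending_of_curve`, the marked point on `L` being the image of its end).
[cite: CossartPiltant2008, Prop. 4.4 (proof, p. 11), Lemma 4.5 (1)] -/
private theorem nonempty_next_of_point_of_pointStep (s : TauOneStage.{u} m) (hpt : (s.base.Y : Set s.base.X) = {s.pt.x}) :
    Nonempty (TauOneNext s) := by
  classical
  haveI := s.base.integral
  haveI := s.base.noeth
  have hX : Scheme.IsRegular s.base.X := s.base.reg
  have hYeq : s.base.Y = ⟨{s.pt.x}, s.pt.closed⟩ := TopologicalSpace.Closeds.ext hpt
  obtain ⟨X', π, hπ⟩ := exists_isBlowup s.base.X (vanishingIdeal (⟨{s.pt.x}, s.pt.closed⟩ : Closeds s.base.X))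
  have hbad : ∀ z : s.base.X, (m : ℕ∞) ≤ idealOrder s.base.J z → z = s.pt.x ∨ z ∉ (s.base.W : Set s.base.X) :=
    fun z hz => (s.base.bad z hz).imp (fun h => by rw [hpt] at h; exact h) id
  have hord : idealOrder s.base.J s.pt.x = m := s.base.Yord _ s.pt.xY
  have hxW : s.pt.x ∈ s.base.W := s.base.YW s.pt.xY
  rcases exists_not_orderReducible_of_point_step hm hρ1 hX s.base.qe s.base.dim3 s.base.J s.base.le s.base.codim s.base.W
      s.pt.x hxW s.pt.closed hbad hord s.pt.dim π hπ s.base.notRed with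
    ⟨hint', hnoeth', hX', hqe', hX3', hle', hcodim', x', hx'x, hnear', W', hx'W', -, hcl', hbad', hord', hdim', hτ', -, hnot'⟩ |
    ⟨hint', hnoeth', hX', hqe', hX3', hle', hcodim', η', hη'x, hcoh', hregL, W', hLW, hW'W, hbadL, hordL, hnotL⟩
  · -- (P1): the next stage is the bad near point `x'`
    haveI := hint'
    haveI := hnoeth'
    let b' : TauOneBase.{u} m :=
      { X := X', J := controlledTransform π (vanishingIdeal (⟨{s.pt.x}, s.pt.closed⟩ : Closeds s.base.X)) s.base.J m, W := W',
        Y := ⟨{x'}, hcl'⟩, integral := hint', noeth := hnoeth', reg := hX', qe := hqe', dim3 := hX3', le := hle',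
        codim := hcodim', YW := Set.singleton_subset_iff.mpr hx'W', Yirr := isIrreducible_singleton,
        Yreg := CampaignW46.isRegular_subscheme_vanishingIdeal_singleton hcl',
        Yord := fun z hz => by rw [Set.mem_singleton_iff.mp hz]; exact hord',
        bad := fun z hz => (hbad' z hz).imp (fun h => Set.mem_singleton_iff.mpr h) id, notRed := hnot' }
    let t : TauOneStage.{u} m := ⟨b', ⟨x', Set.mem_singleton x', hcl', hdim', hτ'⟩⟩
    refine ⟨⟨t, ⟨π, ?_, ?_, hx'x, ?_⟩, Pending.last rfl⟩⟩
    · rw [hYeq]; exact hπ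
    · change controlledTransform π _ s.base.J m = _
      rw [hYeq]
    · change IsNear π (vanishingIdeal s.base.Y) s.base.J m x'
      rw [hYeq]; exact hnear'
  · -- (P2): the whole directrix line `L = cl{η'}` is bad; compute its lineage and mark the image of its end
    haveI := hint'
    haveI := hnoeth'
    let b' : TauOneBase.{u} m :=
      { X := X', J := controlledTransform π (vanishingIdeal (⟨{s.pt.x}, s.pt.closed⟩ : Closeds s.base.X)) s.base.J m,
        W := W', Y := ⟨closure {η'}, isClosed_closure⟩, integral := hint', noeth := hnoeth', reg := hX',
        qe := hqe', dim3 := hX3', le := hle', codim := hcodim', YW := hLW, Yirr := isIrreducible_singleton.closure,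
        Yreg := hregL, Yord := hordL, bad := hbadL, notRed := hnotL }
    -- the colength at the generic point of the line is finite
    have hη'supp : η' ∈ (controlledTransform π (vanishingIdeal (⟨{s.pt.x}, s.pt.closed⟩ : Closeds s.base.X)) s.base.J m).support := by
      rw [← one_le_idealOrder_iff, hordL η' (subset_closure rfl)]
      exact_mod_cast hm
    haveI := hX' η'
    have hmax := mem_maxPoints_support_of_coheight_eq_two hcodim' hη'supp hcoh'
    have hfin := length_quotient_stalkIdeal_ne_top_of_mem_maxPoints hmax
    obtain ⟨N, hN⟩ := ENat.ne_top_iff_exists.mp hfin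
    have hlen : Module.length (X'.presheaf.stalk η') (X'.presheaf.stalk η' ⧸
        stalkIdeal (controlledTransform π (vanishingIdeal (⟨{s.pt.x}, s.pt.closed⟩ : Closeds s.base.X)) s.base.J m) η') <
        (N + 1 : ℕ) := by
      rw [← hN]; exact_mod_cast Nat.lt_succ_self N
    obtain ⟨p, ⟨pend⟩⟩ := exists_pending_of_curve hm (N + 1) b' η' rfl hcoh' hlen
    have hpx : π p.x = s.pt.x := by
      have hsub : closure ({η'} : Set X') ⊆ π ⁻¹' {s.pt.x} :=
        closure_minimal (Set.singleton_subset_iff.mpr hη'x) (s.pt.closed.preimage π.continuous)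
      exact hsub p.xY
    refine ⟨⟨⟨b', p⟩, ⟨π, ?_, ?_, hpx, ?_⟩, pend⟩⟩
    · rw [hYeq]; exact hπ
    · change controlledTransform π _ s.base.J m = _
      rw [hYeq]
    · change IsNear π (vanishingIdeal s.base.Y) s.base.J m p.x
      rw [hYeq]; exact hordL _ p.xY

/-! ## The descent with STEP-P plugged in -/

include hm hρ1 in
/-- **THE ISOLATED `τ = 1` POINT SLICE FROM T1 AND ρ1′** (census S3 ⊇ T1; skeleton v5.2 `stub_tauOne_point`, rich form): GIVEN the chain
termination theorem T1 (oracle `hT1` = `stub_T1_false_of_nearChain_tau_one`, SIGNATURES v4 l.340, binders verbatim) and the point-step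
bookkeeping ρ1′ (oracle `hρ1`), an isolated closed threefold point `x ∈ V` of order `m` with `τ = 1` on an integral Noetherian regular
quasi-excellent `X` of dimension `≤ 3` (`ord J ≤ m`, `V(J)` of codimension `≥ 2`) has `(V, J|_V, m)` ORDER-REDUCIBLE: otherwise the point
step (`nonempty_next_of_point_of_pointStep`) and the curve lineage (`exists_pending_of_curve`) never stop, and the marked points of the
resulting infinite descent form a chain forbidden by T1 (Cossart–Piltant 2008, proof of Prop. 4.4, p. 11: "we get a sequence of points
`x_{σ(i)}` … `τ(x_{σ(i)}) = 1` for all `i ≥ 0` … a contradiction"). [cite: CossartPiltant2008, Prop. 4.4 (proof, p. 11), Lemma 4.5] -/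
theorem orderReducible_comap_of_isolated_tau_one_of_T1
    (hT1 : ∀ (Xs : ℕ → Scheme.{u}) (_hN : ∀ n, IsLocallyNoetherian (Xs n)) (hXreg : ∀ n, Scheme.IsRegular (Xs n))
      (π : ∀ n, Xs (n + 1) ⟶ Xs n) (Y : ∀ n, Closeds (Xs n)) (y : ∀ n, Xs (n + 1))
      (J : ∀ n, (Xs n).IdealSheafData) ⦃μ : ℕ⦄ (_hμ : 1 ≤ μ)
      (_hy : ∀ n, π (n + 1) (y (n + 1)) = y n)
      (_hmem : ∀ n, π n (y n) ∈ (Y n : Set (Xs n)))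
      (_hcl : ∀ n, IsClosed ({π n (y n)} : Set (Xs n)))
      (_hYirr : ∀ n, IsIrreducible ((Y n : Closeds (Xs n)) : Set (Xs n)))
      (_hYreg : ∀ n, Scheme.IsRegular (vanishingIdeal (Y n)).subscheme)
      (_hYord : ∀ n, ∀ z ∈ (Y n : Set (Xs n)), idealOrder (J n) z = μ)
      (_hπ : ∀ n, IsBlowup (π n) (vanishingIdeal (Y n)))
      (_hJ : ∀ n, J (n + 1) = controlledTransform (π n) (vanishingIdeal (Y n)) (J n) μ)
      (_hbd : ∀ n (z : Xs n), idealOrder (J n) z ≤ μ)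
      (_hcodim : ∀ n, ∀ z ∈ (J n).support, 1 < Order.coheight z)
      (_hd : ∀ n, (maximalIdeal ((Xs n).presheaf.stalk (π n (y n)))).spanFinrank = 3)
      (_hnear : ∀ n, IsNear (π n) (vanishingIdeal (Y n)) (J n) μ (y n))
      (_hτ : ∀ n, @stalkTau (Xs n) (J n) (π n (y n)) (hXreg n (π n (y n))) μ = 1)
      (_hG : ∀ n, IsGRing ((Xs n).presheaf.stalk (π n (y n))))
      (_hcoinc : ∀ n (z : Xs n), z ⤳ π n (y n) → idealOrder (J n) z = μ → z ∈ (Y n : Set (Xs n))),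
      False) :
    ∀ {X : Scheme.{u}} [IsIntegral X] [IsNoetherian X] (hX : Scheme.IsRegular X) (_hqe : Scheme.IsQuasiExcellent X)
    (_hX3 : topologicalKrullDim X ≤ 3) (J : X.IdealSheafData) (_hle : ∀ z, idealOrder J z ≤ m)
    (_hcodim : ∀ z ∈ J.support, 1 < Order.coheight z) (V : X.Opens) (x : X) (_hxV : x ∈ V)
    (_hcl : IsClosed ({x} : Set X)) (_hbad : ∀ z : X, (m : ℕ∞) ≤ idealOrder J z → z = x ∨ z ∉ (V : Set X))
    (_hord : idealOrder J x = m) (_hdim : (maximalIdeal (X.presheaf.stalk x)).spanFinrank = 3)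
    (_hτ : haveI := hX x; stalkTau J x m = 1) (_hG : IsGRing (X.presheaf.stalk x)),
    CampaignW46.OrderReducible (J.comap V.ι) m := by
  intro X _ _ hX hqe hX3 J hle hcodim V x hxV hcl hbad hord hdim hτ _hG
  classical
  by_contra hnot
  -- the initial point stage
  let b₀ : TauOneBase.{u} m :=
    { X := X, J := J, W := V, Y := ⟨{x}, hcl⟩, integral := inferInstance, noeth := inferInstance, reg := hX, qe := hqe,
      dim3 := hX3, le := hle, codim := hcodim, YW := Set.singleton_subset_iff.mpr hxV, Yirr := isIrreducible_singleton,
      Yreg := CampaignW46.isRegular_subscheme_vanishingIdeal_singleton hcl,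
      Yord := fun z hz => by rw [Set.mem_singleton_iff.mp hz]; exact hord,
      bad := fun z hz => (hbad z hz).imp (fun h => Set.mem_singleton_iff.mpr h) id, notRed := hnot }
  let s₀ : TauOneStage.{u} m := ⟨b₀, ⟨x, Set.mem_singleton x, hcl, hdim, hτ⟩⟩
  let st₀ : (s : TauOneStage.{u} m) × Pending s := ⟨s₀, Pending.last rfl⟩
  -- one step of the descent: read off the pending chain, or compute the next point step
  let step : ∀ sp : (s : TauOneStage.{u} m) × Pending s, (t : TauOneStage.{u} m) × TauOneLink sp.1 t × Pending t :=
    fun sp => Pending.casesOn (motive := fun s _ => (t : TauOneStage.{u} m) × TauOneLink s t × Pending t) sp.2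
      (fun {s} hpt =>
        let nx : TauOneNext s := Classical.choice (nonempty_next_of_point_of_pointStep hm hρ1 s hpt)
        ⟨nx.t, nx.link, nx.rest⟩)
      (fun {s} t l rest => ⟨t, l, rest⟩)
  let chain : ℕ → (s : TauOneStage.{u} m) × Pending s :=
    fun n => Nat.rec st₀ (fun _ sp => ⟨(step sp).1, (step sp).2.2⟩) n
  -- the data of the chain
  let Xs : ℕ → Scheme.{u} := fun n => (chain n).1.base.X
  let πs : ∀ n, Xs (n + 1) ⟶ Xs n := fun n => (step (chain n)).2.1.π
  let Ys : ∀ n, Closeds (Xs n) := fun n => (chain n).1.base.Y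
  let ys : ∀ n, Xs (n + 1) := fun n => (chain (n + 1)).1.pt.x
  let Js : ∀ n, (Xs n).IdealSheafData := fun n => (chain n).1.base.J
  have hreg : ∀ n, Scheme.IsRegular (Xs n) := fun n => (chain n).1.base.reg
  haveI : ∀ n, IsNoetherian (Xs n) := fun n => (chain n).1.base.noeth
  have e : ∀ n, πs n (ys n) = (chain n).1.pt.x := fun n => (step (chain n)).2.1.apply_x
  refine hT1 Xs (fun n => inferInstance) hreg πs Ys ys Js hm (fun n => e (n + 1)) (fun n => ?_) (fun n => ?_)
    (fun n => (chain n).1.base.Yirr) (fun n => (chain n).1.base.Yreg) (fun n => (chain n).1.base.Yord)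
    (fun n => (step (chain n)).2.1.blowup) (fun n => (step (chain n)).2.1.transform) (fun n => (chain n).1.base.le)
    (fun n => (chain n).1.base.codim) (fun n => ?_) (fun n => (step (chain n)).2.1.near) (fun n => ?_) (fun n => ?_)
    (fun n z hz hzord => ?_)
  · -- `x_n ∈ Y_n`
    rw [e n]; exact (chain n).1.pt.xY
  · -- `x_n` is closed
    rw [e n]; exact (chain n).1.pt.closed
  · -- embedding dimension `3`
    rw [CampaignW46.spanFinrank_maximalIdeal_congr (e n)]; exact (chain n).1.pt.dim
  · -- `τ(x_n) = 1`
    rw [CampaignW46.stalkTau_congr (hreg n) (Js n) m (e n)]; exact (chain n).1.pt.tau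
  · -- G-ring
    exact CampaignW46.isGRing_stalk_congr (e n).symm
      (Scheme.isGRing_stalk_of_isQuasiExcellent (chain n).1.base.qe _)
  · -- the regime (*): a generization of `x_n` of order `m` lies in `W_n`, hence on `Y_n`
    rw [e n] at hz
    have hzW : z ∈ ((chain n).1.base.W : Set (Xs n)) :=
      hz.mem_open (chain n).1.base.W.2 ((chain n).1.base.YW (chain n).1.pt.xY)
    rcases (chain n).1.base.bad z hzord.ge with h | h
    · exact h
    · exact absurd hzW h

end Oracles

end CP2008Prop44

end Summit.ResolutionOfSingularities.ResolutionOfSingularities.Theorems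

end
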